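import Literature.AnabelianGeometry.EtaleTheta.Discharge.Sec3HQOfRationalSupport
import Literature.AnabelianGeometry.EtaleTheta.TemperedFrobenioidToyGenuine
import Literature.AnabelianGeometry.EtaleTheta.MonoprimeStructure
import HarnessLib

/-!
# [EtTh] Def 3.6 (ii) / Cor 3.8, row C38-L05: the hypotheses (hZQ), (hsat) of `Sec3HQOfRationalSupport` are
# INHABITED at the tree's genuine-vocabulary tempered Frobenioid, where `hQ` therefore holds OUTRIGHT

Proof-only non-vacuity companion of `Discharge/Sec3HQOfRationalSupport.lean` (p433386; cell abc-iut, seat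
abc-iut-w5-d130 gen 5, row «hQ-FROM-Φ₀», GAP-LEDGER G-w4d084-3 / D-G-w4d084-3).  S. Mochizuki, *The étale theta
function …*, Publ. RIMS **45** (2009) [EtTh], Remark 3.3.1 p.73, Def. 3.6 (i)–(ii) pp.76–77, proof of Cor. 3.8 p.81
(PDF) [cite: MochizukiEtTh2009, Def 3.6 p.76]; S. Mochizuki, *The geometry of Frobenioids I* [FrdI], §0 p.10, p.12.

At abc-iut-w5-d164's CONSTRUCTED tempered Frobenioid `Toy.genuineTemperedFrobenioid R S` (p427934: genuine [FrdI]
vocabularies `treeMonoidVocab` / `treeCatVocab`, realified data `ofRlfZ Toy.divisorMonoids _`, `Φ₀ = ℤ_{≥0}`,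
`Φ := im(Φ₀^pf → Φ₀^rlf)`, Frobenioid certificate `Toy.isFrobenioid_genuineTemperedFrobenioid`):
* (hZQ) holds: every prime `𝔭` of the `ℤ`-monoprime `Φ₀(Y) = ℤ_{≥0}` has `Φ₀(Y)_𝔭 = Φ₀(Y) ≅ ℤ_{≥0}` (a monoprime
  monoid is archimedean, `MonoprimeStructure.submonoid_eq_top`) — in general `isZMonoprime_submonoid_primes`,
  `isQMonoprime_submonoid_primes`, `isZQMonoprime_submonoid_primes_of_isMonoprime_of_not_isRMonoprime`;
* (hsat) holds: `Φ(A) = im(Φ₀^pf)` consists of roots of images of `Φ₀` (`Toy.ratSupport_genuine`);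
hence **`Toy.hQ_genuine`: every `Φ(W)^pf_𝔮` is `ℚ`-monoprime at the genuine toy, with NO binder**, by
`TemperedFrobenioid.isQMonoprime_pfAt_divisorMonoid_of_ratSupport`.  (Row C38-L05 itself is already landed there —
abc-iut-w5-d164's `Toy.bsFldPreStepLimitCriterion_genuine`, `Sec3Cor38CriterionToyGenuine.lean`, via `hSup`; the
(hZQ, hsat) route `bsFldPreStepLimitCriterion_of_ratSupport … (exists_cnstFn_effective_genuineTemperedFrobenioid R S)
(fun _ => isZQMonoprime_primes_Φ₀ _) (fun _ => ratSupport_genuine R S _)` re-derives the same statement and is not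
re-declared.)  HONEST LABEL: degenerate geometry (one object, one prime, `Λ = ℤ`); a consistency / instantiation
witness for the hypotheses of p433386 only; refereed pre-IUT material; nothing here bears on [IUTchIII] Cor. 3.12;
typed ≠ proved.
-/

noncomputable section

namespace Literature.AnabelianGeometry.EtaleTheta

open CategoryTheory Opposite Function Literature.AlgebraicGeometry.Frobenioids

universe u

/-! ### Primes of a monoprime monoid of type `ℤ` / `ℚ` (general) -/

namespace HQRatCoord

variable {N : Type u} [CommMonoid N]

/-- Every `N_𝔭` of a `ℤ`-monoprime monoid `N` is `ℤ`-monoprime (`N_𝔭 = N`: a monoprime monoid is archimedean,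
[FrdI] §0 p.12). [cite: MochizukiFrdI2008, §0 p.12] -/
theorem isZMonoprime_submonoid_primes (hN : IsZMonoprime N) (𝔭 : Primes N) : IsZMonoprime ↥𝔭.submonoid := by
  obtain ⟨e⟩ := MonoprimeStructure.nonempty_submonoid_mulEquiv
    (fun _ _ hb => MonoprimeStructure.precsim_of_ne_one (IsMonoprime.ofZ hN) hb) 𝔭
  exact hN.of_mulEquiv e.symm

/-- Every `N_𝔭` of a `ℚ`-monoprime monoid `N` is `ℚ`-monoprime. [cite: MochizukiFrdI2008, §0 p.12] -/
theorem isQMonoprime_submonoid_primes (hN : IsQMonoprime N) (𝔭 : Primes N) : IsQMonoprime ↥𝔭.submonoid := by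
  obtain ⟨e⟩ := MonoprimeStructure.nonempty_submonoid_mulEquiv
    (fun _ _ hb => MonoprimeStructure.precsim_of_ne_one (IsMonoprime.ofQ hN) hb) 𝔭
  exact hN.of_mulEquiv e.symm

/-- (hZQ) for a monoprime monoid that is not of type `ℝ`. [cite: MochizukiFrdI2008, §0 p.12] -/
theorem isZQMonoprime_submonoid_primes_of_isMonoprime_of_not_isRMonoprime (hN : IsMonoprime N)
    (hR : ¬ IsRMonoprime N) (𝔭 : Primes N) : IsZMonoprime ↥𝔭.submonoid ∨ IsQMonoprime ↥𝔭.submonoid := by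
  rcases hN with hZ | hQ | hR'
  · exact Or.inl (isZMonoprime_submonoid_primes hZ 𝔭)
  · exact Or.inr (isQMonoprime_submonoid_primes hQ 𝔭)
  · exact absurd hR' hR

end HQRatCoord

/-! ### The genuine toy: (hZQ), (hsat) discharged, `hQ` outright -/

namespace Toy

open Example39NV

variable (R S : ((Discrete PUnit.{1})ᵒᵖ ⥤ CommMonCat.{0}) → Prop)

/-- (hZQ) at the toy data: every prime component of `Φ₀(Y) = ℤ_{≥0}` is `ℤ`-monoprime.
[cite: MochizukiEtTh2009, Rmk 3.3.1 p.73] -/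
theorem isZQMonoprime_primes_Φ₀ (Y : (Discrete PUnit.{1})ᵒᵖ) (𝔭 : Primes (divisorMonoids.Φ₀.obj Y)) :
    IsZMonoprime ↥𝔭.submonoid ∨ IsQMonoprime ↥𝔭.submonoid :=
  Or.inl (HQRatCoord.isZMonoprime_submonoid_primes (N := Multiplicative ℕ) ⟨⟨MulEquiv.refl _⟩⟩ 𝔭)

/-- (hsat) at the genuine toy: every divisor `x ∈ Φ(A) = im(Φ₀^pf → Φ₀^rlf)` has a power in the image of `Φ₀(A)`
(`x = ι(m^{1/n})` gives `x^n = ι(m)`). [cite: MochizukiEtTh2009, Def 3.6 p.76] -/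
theorem ratSupport_genuine (A : (Discrete PUnit.{1})ᵒᵖ) :
    ∀ x ∈ (genuineTemperedFrobenioid R S).Φ.carrier A, ∃ (N : ℕ+) (d : realifiedGenuine.Φ₀.obj A),
      x ^ (N : ℕ) = realifiedGenuine.toR A d := by
  intro x hx
  obtain ⟨a, ha⟩ := (mem_pfImage_iff A x).mp hx
  obtain ⟨⟨m, n⟩, rfl⟩ := Perfection.mk_surjective a
  refine ⟨n, m, ?_⟩
  rw [← ha]
  change (isPerfFactorial_Φ₀ A).toRealification (Perfection.mk m n) ^ (n : ℕ) =
    (isPerfFactorial_Φ₀ A).toRealification (Perfection.of _ m)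
  rw [← map_pow, Perfection.mk_pow_self]

/-- **`hQ` OUTRIGHT at the genuine toy**: every localized perfection `Φ(W)^pf_𝔮` of the divisor monoid of
`Toy.genuineTemperedFrobenioid R S` is `ℚ`-monoprime — by `isQMonoprime_pfAt_divisorMonoid_of_ratSupport` with
(hZQ), (hsat) discharged. [cite: MochizukiEtTh2009, Def 3.6 p.77] -/
theorem hQ_genuine (W : Discrete PUnit.{1})
    (𝔮 : Primes (Perfection ((genuineTemperedFrobenioid R S).divisorMonoid.obj (op W)))) :
    IsQMonoprime (PfAt ((genuineTemperedFrobenioid R S).divisorMonoid.obj (op W)) 𝔮) :=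
  TemperedFrobenioid.isQMonoprime_pfAt_divisorMonoid_of_ratSupport W (isZQMonoprime_primes_Φ₀ _)
    (ratSupport_genuine R S _) 𝔮

end Toy

end Literature.AnabelianGeometry.EtaleTheta

end
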